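import Summits.HodgeConjecture.CorCM.GaloisTwiceOddExceptionalClasses
import HarnessLib

/-!
# Half subsets of `Gal(K/k)` with trivial generalised stabiliser: primitive CM types of Weil type over the
# imaginary quadratic subfield `k`, and the dihedral Galois groups `D_p`, `p ≥ 5`

COR-CM (cell `pub-hodgecm2`), binder seat b04 (gen 19), count-neutral claim GALOIS-TWICE-ODD, part VI (the
EVEN-degree mechanism complementary to parts II–V).  KERNEL ONLY: theorems; no definition, no named fact, no
`sorry`.  `HC_CM` is neither used nor claimed.

SETTING as in part II: `G ⊇ H` of index `2`, `c ∉ H` a central involution (`G = Gal(K/ℚ)`, `H = Gal(K/k)` for an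
imaginary quadratic subfield `k`).  When `|H| = 2q` is EVEN a second degeneracy mechanism is available: a subset
`N ⊆ H` with `|N| = q = |H|/2` makes the half system `S = N ∪ c(H ∖ N)` balanced over `k` — the whole of `H`
(i.e. the fibre `{σ_h : h ∈ H}` of `Hom(K,ℂ) → Hom(k,ℂ)`) is a balanced set moved by `c`, so the type is of WEIL TYPE
over `k` and DEGENERATE (`two_mul_card_filter_halfSystem_of_halfSubset`); and `S` is PRIMITIVE as soon as `N` has
trivial *generalised* stabiliser: `uN ≠ N` for `u ∈ H ∖ {1}` and `uN ≠ H ∖ N` for all `u ∈ H`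
(`exists_not_iff_of_halfSubset`).

* §1–§2 the mechanism and its field dress **`exists_isPrimitive_not_isNondegenerate_of_halfSubset`**,
  **`exists_simple_exceptional_of_halfSubset`** (a simple CM abelian variety of dimension `[K:k] = 2q` with an
  exceptional Hodge class in the middle codimension `q` — a Weil class of `k`).
* §3 **the dihedral groups**: if `Gal(K/k)` contains `r` of prime order `p ≥ 5` and `s ∉ ⟨r⟩` with `s r s⁻¹ = r⁻¹`
  and `[K : k] = 2p` (so `Gal(K/k) ≅ D_p`), the half subset `N = {1, r, …, r^{p−3}, s, s r²}` has trivial generalised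
  stabiliser (**`exists_halfSubset_dihedral`**), whence (**`exists_simple_degenerate_of_dihedral`**) a simple
  DEGENERATE CM abelian variety of dimension `2p` with CM by `K` — in contrast with `p = 3` (`Gal(K/ℚ) ≅ ℤ/2 × S₃`,
  every simple CM sixfold nondegenerate, gen 14 `GaloisDodecic`).  Seat census (kernel-free oracle): for `p = 5`
  exactly `200` of the `720` primitive CM sets of `ℤ/2 × D₅` are degenerate, all of corank `1`.

## References

* [Dodson1984] B. Dodson, *The structure of Galois groups of CM-fields*, Trans. AMS 283 (1984), §3.1.1 (the
  exceptional case "weight `n/2`" of the constant weight criterion), §3.3.1 (C), §4.1 (dihedral groups).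
* [Gordon1999HodgeAVSurvey] B. B. Gordon, *A survey of the Hodge conjecture for abelian varieties*, 9.2.2, §9.4.3
  (Theorem [B.140], Yanai: `a = b`).
* [Shimura1998] G. Shimura, *Abelian Varieties with Complex Multiplication and Modular Functions*, §6.2 Thm. 3, §8.2 Prop. 26.
-/

noncomputable section

open CategoryTheory CategoryTheory.Limits NumberField
open scoped BigOperators

namespace Summit.HodgeConjecture.CorCM.TwiceOdd

open Literature.NumberTheory.ComplexMultiplication
open Literature.AlgebraicGeometry.Motives (AbelianVariety CMType)
open Literature.AlgebraicGeometry.HodgeTheory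
open Literature.AlgebraicGeometry.ComplexMultiplication (IsCMTypeRealisation isSimple_iff_isPrimitive)
open Literature.AlgebraicGeometry.Pohlmann1968
open Literature.Barriers.HodgeConjecture (divisorClassesSpan)
open Summit.HodgeConjecture.CorCM.GaloisOctic (embOf_complexConj_mul complexConj_mul_comm complexConj_mul_self
  complexConj_not_mem_fixingSubgroup)
open Summit.HodgeConjecture.CorCM.AbelianSixteen (exists_simple_realisation_of_isPrimitive)

open scoped Classical

/-! ## §1 Group level: half subsets with trivial generalised stabiliser -/

section Group

variable {G : Type*} [Group G] [Fintype G] {c : G} {H : Subgroup G} {N S : Finset G}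

/-- **Trivial generalised stabiliser ⟹ the half system has trivial left stabiliser in `G`.**  If `uN ≠ N` for
`u ∈ H ∖ {1}` and `uN ∩ N ≠ ∅` for all `u ∈ H` (so `uN ≠ H ∖ N`), then no `v ≠ 1` of `G` stabilises
`S = N ∪ c(H ∖ N)` (for `v = c h₁ ∉ H`, `vS = S` would force `h₁ N ⊆ H ∖ N`). [cite: Shimura1998, §8.2 Prop. 26] -/
theorem exists_not_iff_of_halfSubset (hcc : c * c = 1) (hcH : c ∉ H) (hH : ∀ g : G, g ∈ H ∨ c * g ∈ H)
    (hNH : ∀ n ∈ N, n ∈ H) (hS : ∀ g : G, g ∈ S ↔ g ∈ N ∨ (g ∉ H ∧ c * g ∉ N))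
    (h₁ : ∀ u ∈ H, u ≠ 1 → ∃ n ∈ N, u * n ∉ N) (h₂ : ∀ u ∈ H, ∃ n ∈ N, u * n ∈ N) (v : G) (hv : v ≠ 1) :
    ∃ w : G, ¬ (w ∈ S ↔ v * w ∈ S) := by
  by_contra hall
  push Not at hall
  by_cases hvH : v ∈ H
  · obtain ⟨n, hn, hun⟩ := h₁ v hvH hv
    exact hun ((mem_halfSystem_iff_of_mem hS (H.mul_mem hvH (hNH n hn))).1
      ((hall n).1 ((mem_halfSystem_iff_of_mem hS (hNH n hn)).2 hn)))
  · set h₁' : G := c * v with hh₁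
    have hh₁H : h₁' ∈ H := (mul_mem_iff_not_mem hcH hH v).2 hvH
    have hvh : v = c * h₁' := by rw [hh₁, ← mul_assoc, hcc, one_mul]
    obtain ⟨n, hn, hn'⟩ := h₂ h₁' hh₁H
    have hnS : n ∈ S := (mem_halfSystem_iff_of_mem hS (hNH n hn)).2 hn
    have hvn : v * n ∈ S := (hall n).1 hnS
    have hvnH : v * n ∉ H := by
      rw [hvh, mul_assoc]
      exact fun h => ((mul_mem_iff_not_mem hcH hH _).1 h) (H.mul_mem hh₁H (hNH n hn))
    have h := (mem_halfSystem_iff_of_not_mem hNH hS hvnH).1 hvn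
    rw [hvh, mul_assoc, ← mul_assoc c c, hcc, one_mul] at h
    exact h hn'

/-- **`|N| = |H|/2` ⟹ the whole of `H` is a balanced set for the half system `S`**: every right translate `S g`
contains exactly `|H|/2` elements of `H` (`|{x ∈ H : x g ∈ N}| = |N|` for `g ∈ H`, and `|{x ∈ H : c x g ∉ N}| =
|H| − |N|` for `g ∉ H`) — Pohlmann's condition for the fibre of `Hom(K,ℂ) → Hom(k,ℂ)`: the type is of Weil type
over `k`. [cite: Dodson1984, §3.1.1] [cite: Gordon1999HodgeAVSurvey, §9.4.3] -/
theorem two_mul_card_filter_halfSystem_of_halfSubset (hcz : ∀ g : G, c * g = g * c) (hcH : c ∉ H)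
    (hH : ∀ g : G, g ∈ H ∨ c * g ∈ H) (hNH : ∀ n ∈ N, n ∈ H)
    (hS : ∀ g : G, g ∈ S ↔ g ∈ N ∨ (g ∉ H ∧ c * g ∉ N)) (hcard : 2 * N.card = Nat.card H) (g : G) :
    2 * ((Finset.univ.filter fun x : G => x ∈ H).filter fun x => x * g ∈ S).card =
      (Finset.univ.filter fun x : G => x ∈ H).card := by
  set HF : Finset G := Finset.univ.filter fun x : G => x ∈ H with hHF
  have hmemH : ∀ x, x ∈ HF ↔ x ∈ H := fun x => by rw [hHF, Finset.mem_filter]; simp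
  have hHFc : HF.card = Nat.card H := by rw [hHF, Nat.card_eq_fintype_card, ← Fintype.card_subtype]
  -- `#{x ∈ H : x y ∈ N} = |N|` for `y ∈ H`
  have hcount : ∀ y ∈ H, (HF.filter fun x => x * y ∈ N).card = N.card := by
    intro y hy
    have himg : (HF.filter fun x => x * y ∈ N).image (fun x => x * y) = N := by
      ext n
      rw [Finset.mem_image]
      constructor
      · rintro ⟨x, hx, rfl⟩
        exact (Finset.mem_filter.1 hx).2
      · intro hn
        refine ⟨n * y⁻¹, Finset.mem_filter.2 ⟨(hmemH _).2 (H.mul_mem (hNH n hn) (H.inv_mem hy)), ?_⟩, ?_⟩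
        · rw [inv_mul_cancel_right]; exact hn
        · rw [inv_mul_cancel_right]
    rw [← Finset.card_image_of_injective (HF.filter fun x => x * y ∈ N) (mul_left_injective y), himg]
  by_cases hg : g ∈ H
  · have h1 : (HF.filter fun x => x * g ∈ S) = HF.filter fun x => x * g ∈ N := by
      refine Finset.filter_congr fun x hx => ?_
      exact mem_halfSystem_iff_of_mem hS (H.mul_mem ((hmemH x).1 hx) hg)
    rw [h1, hcount g hg, hcard, hHFc]
  · have hg' : c * g ∈ H := (mul_mem_iff_not_mem hcH hH g).2 hg
    have h1 : (HF.filter fun x => x * g ∈ S) = HF.filter fun x => ¬ (x * (c * g) ∈ N) := by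
      refine Finset.filter_congr fun x hx => ?_
      have hxH : x ∈ H := (hmemH x).1 hx
      have hout : x * g ∉ H := fun h => hg (by simpa using H.mul_mem (H.inv_mem hxH) h)
      rw [mem_halfSystem_iff_of_not_mem hNH hS hout, ← mul_assoc, hcz x, mul_assoc]
    rw [h1]
    have h2 := Finset.card_filter_add_card_filter_not (s := HF) (fun x => x * (c * g) ∈ N)
    rw [hcount _ hg'] at h2
    omega

/-- `1 ∈ H`, `c ∉ H` as finset statements. [folklore] -/
theorem one_mem_filter_and_not_mem (hcH : c ∉ H) :
    (1 : G) ∈ (Finset.univ.filter fun x : G => x ∈ H) ∧ c ∉ (Finset.univ.filter fun x : G => x ∈ H) := by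
  simp [H.one_mem, hcH]

/-- **Package.**  `G ⊇ H` of index `2`, `c ∉ H` a central involution; `N ⊆ H` with `2|N| = |H|` and trivial
generalised stabiliser ⟹ a CM set `S` with trivial left stabiliser and a balanced set `D` (namely `H`) with
`1 ∈ D`, `c ∉ D`, `#D = 2|N|`. [cite: Dodson1984, §3.1.1] [cite: Shimura1998, §8.2 Prop. 26] -/
theorem exists_halfSystem_of_halfSubset (hcc : c * c = 1) (hcz : ∀ g : G, c * g = g * c) (hcH : c ∉ H)
    (hH : ∀ g : G, g ∈ H ∨ c * g ∈ H) (hNH : ∀ n ∈ N, n ∈ H) (hcard : 2 * N.card = Nat.card H)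
    (h₁ : ∀ u ∈ H, u ≠ 1 → ∃ n ∈ N, u * n ∉ N) (h₂ : ∀ u ∈ H, ∃ n ∈ N, u * n ∈ N) :
    ∃ S D : Finset G, (∀ g : G, g ∈ S ↔ c * g ∉ S) ∧ (∀ v : G, v ≠ 1 → ∃ w : G, ¬ (w ∈ S ↔ v * w ∈ S)) ∧
      (∀ g : G, 2 * (D.filter fun x => x * g ∈ S).card = D.card) ∧ (1 : G) ∈ D ∧ c ∉ D ∧
      D.card = 2 * N.card := by
  obtain ⟨S, hS⟩ := exists_halfSystem c H N
  obtain ⟨h1D, hcD⟩ := one_mem_filter_and_not_mem hcH (c := c)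
  refine ⟨S, _, isCM_halfSystem hcc hcH hH hNH hS, exists_not_iff_of_halfSubset hcc hcH hH hNH hS h₁ h₂,
    two_mul_card_filter_halfSystem_of_halfSubset hcz hcH hH hNH hS hcard, h1D, hcD, ?_⟩
  rw [hcard, Nat.card_eq_fintype_card, ← Fintype.card_subtype]

end Group

/-! ## §2 Field dress: primitive CM types of Weil type over `k` -/

section Field

variable {K : Type} [Field K] [NumberField K] [IsCMField K]

/-- **Half subsets with trivial generalised stabiliser ⟹ a PRIMITIVE DEGENERATE CM type** (`K/ℚ` Galois CM,
`H ≤ Gal(K/ℚ)` with `c ∉ H`, `G = H ∪ cH`; `N ⊆ H`, `2|N| = |H|`, `uN ≠ N` for `u ∈ H ∖ {1}`, `uN ∩ N ≠ ∅` for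
`u ∈ H`): the half system of `N` is primitive and of Weil type over the fixed field of `H`.
[cite: Shimura1998, §8.2 Prop. 26] [cite: Gordon1999HodgeAVSurvey, §9.4.3] -/
theorem exists_isPrimitive_not_isNondegenerate_of_halfSubset [IsGalois ℚ K] (H : Subgroup (K ≃ₐ[ℚ] K))
    (hcH : (IsCMField.complexConj K).restrictScalars ℚ ∉ H)
    (hH : ∀ g : K ≃ₐ[ℚ] K, g ∈ H ∨ (IsCMField.complexConj K).restrictScalars ℚ * g ∈ H)
    (N : Finset (K ≃ₐ[ℚ] K)) (hNH : ∀ n ∈ N, n ∈ H) (hcard : 2 * N.card = Nat.card H)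
    (h₁ : ∀ u ∈ H, u ≠ 1 → ∃ n ∈ N, u * n ∉ N) (h₂ : ∀ u ∈ H, ∃ n ∈ N, u * n ∈ N) (φ₀ : K →+* ℂ) :
    ∃ Φ : CMType K, IsPrimitive (ℂ ≃+* ℂ) Φ.1 φ₀ ∧ ¬ IsNondegenerate Φ := by
  set c : K ≃ₐ[ℚ] K := (IsCMField.complexConj K).restrictScalars ℚ with hc_def
  obtain ⟨S, D, hcm, hstab, hbal, h1D, hcD, -⟩ := exists_halfSystem_of_halfSubset (c := c) complexConj_mul_self
    (fun g => complexConj_mul_comm g) hcH hH hNH hcard h₁ h₂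
  obtain ⟨Φ, hprim, hread⟩ := GaloisTable.exists_isPrimitive_of_tableModel (K := K) (X := K ≃ₐ[ℚ] K)
    (fun a b => a * b) (Equiv.refl _) (fun _ _ => rfl) c rfl 1 rfl S hcm hstab φ₀
  refine ⟨Φ, hprim, not_isNondegenerate_of_galois_balanced Φ φ₀ S (fun g => ?_) D hbal ⟨1, h1D, ?_⟩⟩
  · simpa using hread g
  · rw [mul_one]; exact hcD

/-- **… realised, with the Weil class ON the simple abelian variety**: a SIMPLE CM abelian variety of dimension
`[K:ℚ]/2 = |H|` with a rational `(|N|,|N|)`-class outside `D^{|N|} ⊗ ℂ` — an exceptional class in the middle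
codimension `|H|/2`. [cite: Gordon1999HodgeAVSurvey, 9.2.2] [cite: Shimura1998, §6.2 Thm. 3 and §8.2 Prop. 26] -/
theorem exists_simple_exceptional_of_halfSubset [IsGalois ℚ K] (H : Subgroup (K ≃ₐ[ℚ] K))
    (hcH : (IsCMField.complexConj K).restrictScalars ℚ ∉ H)
    (hH : ∀ g : K ≃ₐ[ℚ] K, g ∈ H ∨ (IsCMField.complexConj K).restrictScalars ℚ * g ∈ H)
    (N : Finset (K ≃ₐ[ℚ] K)) (hNH : ∀ n ∈ N, n ∈ H) (hcard : 2 * N.card = Nat.card H)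
    (h₁ : ∀ u ∈ H, u ≠ 1 → ∃ n ∈ N, u * n ∉ N) (h₂ : ∀ u ∈ H, ∃ n ∈ N, u * n ∈ N) :
    ∃ (Φ : CMType K) (φ₀ : K →+* ℂ) (A : AbelianVariety ℂ) (ι : 𝓞 K →+* End A)
      (θ : K →+* Module.End ℂ (complexBetti A.X 1)),
      IsPrimitive (ℂ ≃+* ℂ) Φ.1 φ₀ ∧ ¬ IsNondegenerate Φ ∧ IsCMTypeRealisation Φ A ι θ ∧ A.IsSimple ∧
      A.dim = Module.finrank ℚ K / 2 ∧
      ∃ x : complexBetti A.X (2 * N.card), IsRationalClass x ∧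
        IsOfHodgeType (Module.finrank ℚ K / 2) A.X (2 * N.card) N.card N.card x ∧
        x ∉ divisorClassesSpan A.X (Module.finrank ℚ K / 2) N.card := by
  obtain ⟨φ₀⟩ := (inferInstance : Nonempty (K →+* ℂ))
  set c : K ≃ₐ[ℚ] K := (IsCMField.complexConj K).restrictScalars ℚ with hc_def
  obtain ⟨S, D, hcm, hstab, hbal, h1D, hcD, hDcard⟩ := exists_halfSystem_of_halfSubset (c := c)
    complexConj_mul_self (fun g => complexConj_mul_comm g) hcH hH hNH hcard h₁ h₂
  obtain ⟨Φ, hprim, hread⟩ := GaloisTable.exists_isPrimitive_of_tableModel (K := K) (X := K ≃ₐ[ℚ] K)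
    (fun a b => a * b) (Equiv.refl _) (fun _ _ => rfl) c rfl 1 rfl S hcm hstab φ₀
  have hS : ∀ g, g ∈ S ↔ embOf φ₀ g ∈ Φ.1 := fun g => by simpa using hread g
  have hdeg : ¬ IsNondegenerate Φ :=
    not_isNondegenerate_of_galois_balanced Φ φ₀ S hS D hbal ⟨1, h1D, by rw [mul_one]; exact hcD⟩
  obtain ⟨A, ι, θ, hA, hs, hdim⟩ := exists_simple_realisation_of_isPrimitive Φ φ₀ hprim
  exact ⟨Φ, φ₀, A, ι, θ, hprim, hdeg, hA, hs, hdim,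
    exists_exceptional_of_galois_balanced φ₀ hprim S hS D hbal h1D hcD hDcard hA⟩

end Field

end Summit.HodgeConjecture.CorCM.TwiceOdd

end
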